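import Summits.ResolutionOfSingularities.ResolutionOfSingularities.Theorems.RisoStrataRtdLocal

/-!
# Crux `RisoCentresResolve` of route RisoStrata — stub `ta_transcendental_X2` (line Sketch)

In `K = k(t₀, t₁, t₂, t₃)`, the fraction field of `MvPolynomial (Fin 4) k` with `t i` the images
of the variables, the element `t 2` is transcendental over every `k`-subalgebra `B₀` of `K`
contained in `k[t₀, t₁, t₃][(t₁t₃)⁻¹]`, in the concrete form: the `B₀`-algebra map
`Polynomial.aeval (t 2) : (↥B₀)[X] → K` has trivial kernel.

Proof: the family `t` is algebraically independent over `k` (image of `MvPolynomial.X` under the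
injective map to the fraction field), so `t 2` is transcendental over
`Algebra.adjoin k (t '' {0, 1, 3})` (`AlgebraicIndependent.transcendental_adjoin`), hence over the
intermediate field `k(t₀, t₁, t₃)` (an algebraic extension of that subalgebra's image,
`IntermediateField.transcendental_adjoin_iff`), which contains `B₀`; transcendence descends
along `B₀ ≤ k(t₀, t₁, t₃)` (`Transcendental.of_tower_top_of_subalgebra_le`).
-/

set_option linter.dupNamespace false

noncomputable section

namespace Summit.ResolutionOfSingularities.ResolutionOfSingularities.Theorems

/-- In the fraction field `K` of `MvPolynomial (Fin 4) k`, with `t i` the images of the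
variables, `t 2` is transcendental over every `k`-subalgebra `B₀ ≤ k[t₀, t₁, t₃][(t₁t₃)⁻¹]`:
a polynomial over `B₀` vanishing at `t 2` is zero. -/
theorem ta_transcendental_X2 : ∀ (k : Type) [Field k] (t : Fin 4 → FractionRing (MvPolynomial (Fin 4) k)), (∀ i, t i = algebraMap (MvPolynomial (Fin 4) k) (FractionRing (MvPolynomial (Fin 4) k)) (MvPolynomial.X i)) → ∀ (B₀ : Subalgebra k (FractionRing (MvPolynomial (Fin 4) k))), B₀ ≤ Algebra.adjoin k ({t 0, t 1, t 3, (t 1 * t 3)⁻¹} : Set (FractionRing (MvPolynomial (Fin 4) k))) → ∀ q : Polynomial ↥B₀, Polynomial.aeval (t 2) q = 0 → q = 0 := by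
  intro k _ t ht B₀ hB₀
  -- the family `t` is algebraically independent over `k`
  have hind : AlgebraicIndependent k t := by
    have h := (MvPolynomial.algebraicIndependent_X (Fin 4) k).map'
      (f := IsScalarTower.toAlgHom k (MvPolynomial (Fin 4) k)
        (FractionRing (MvPolynomial (Fin 4) k)))
      (IsFractionRing.injective (MvPolynomial (Fin 4) k)
        (FractionRing (MvPolynomial (Fin 4) k)))
    convert h using 1
    funext i
    exact ht i
  -- `t 2` is transcendental over `k[t₀, t₁, t₃]`
  have h2 : (2 : Fin 4) ∉ ({0, 1, 3} : Set (Fin 4)) := by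
    simp only [Set.mem_insert_iff, Set.mem_singleton_iff]
    decide
  have htr : Transcendental ↥(Algebra.adjoin k (t '' ({0, 1, 3} : Set (Fin 4)))) (t 2) :=
    hind.transcendental_adjoin h2
  -- hence over the intermediate field `k(t₀, t₁, t₃)`
  have htrF :
      Transcendental ↥(IntermediateField.adjoin k (t '' ({0, 1, 3} : Set (Fin 4)))) (t 2) :=
    IntermediateField.transcendental_adjoin_iff.mpr htr
  -- `B₀ ≤ k[t₀, t₁, t₃][(t₁t₃)⁻¹] ≤ k(t₀, t₁, t₃)`
  have hmem : ∀ i ∈ ({0, 1, 3} : Set (Fin 4)),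
      t i ∈ IntermediateField.adjoin k (t '' ({0, 1, 3} : Set (Fin 4))) :=
    fun i hi => IntermediateField.subset_adjoin k _ ⟨i, hi, rfl⟩
  have hle : B₀ ≤ (IntermediateField.adjoin k (t '' ({0, 1, 3} : Set (Fin 4)))).toSubalgebra := by
    refine hB₀.trans ?_
    rw [Algebra.adjoin_le_iff]
    intro x hx
    rw [SetLike.mem_coe, IntermediateField.mem_toSubalgebra]
    simp only [Set.mem_insert_iff, Set.mem_singleton_iff] at hx
    rcases hx with rfl | rfl | rfl | rfl
    · exact hmem 0 (by simp)
    · exact hmem 1 (by simp)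
    · exact hmem 3 (by simp)
    · exact inv_mem (mul_mem (hmem 1 (by simp)) (hmem 3 (by simp)))
  -- transcendence descends to `B₀`
  have htrB : Transcendental ↥B₀ (t 2) :=
    Transcendental.of_tower_top_of_subalgebra_le hle htrF
  intro q hq
  exact transcendental_iff_injective.mp htrB (hq.trans (map_zero _).symm)

end Summit.ResolutionOfSingularities.ResolutionOfSingularities.Theorems

end
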